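import Literature.AlgebraicGeometry.Frobenioids.Thm42OfPreStepsGeneral
import Literature.AlgebraicGeometry.Frobenioids.Thm42PrimaryStepsWeak
import Literature.AlgebraicGeometry.Frobenioids.FactorizationTransportWeak
import HarnessLib

/-!
# [FrdI] Theorem 4.2 (i), primary steps, for Frobenioids NOT of perfect type — WEAKLY perf-factorial divisor
# monoids (passage to the perfections)

Mochizuki, *The geometry of Frobenioids I: the general theory*, Kyushu J. Math. **62** (2008) 293–400, §4,
Theorem 4.2 (i), statement p. 77, proof p. 78 l. 28 – p. 80 l. 17 (kurims) [cite: MochizukiFrdI2008, Thm. 4.2 (i) p.77];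
"passing to the perfections" p. 78 ll. 40–46 [cite: MochizukiFrdI2008, Thm. 4.2 (i) p.78]; Def. 2.4 (i) p. 47–48
[cite: MochizukiFrdI2008, Def. 2.4 (i) p.47].

PROOF-ONLY file (cell abc-iut, layer L1, node `FrdI:Thm4.2`; seat abc-iut-L1-t12, holder of abc-iut-L2-d2's request
«re-type the Thm. 4.2 (i) chain over `IsPerfFactorialWeak`» per L1-lead R129).  The tree proves "`Ψ`, `Ψ⁻¹` preserve
pre-steps ⟹ `Ψ` preserves primary pre-steps" for Frobenioids whose divisor monoids `Φ_i(A)` are perf-factorial AS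
PRINTED (Def. 2.4 (i) (a)–(d); `FrdI.T42.thm42i_ofFunctor_of_preservesPreSteps`, seat abc-iut-w4-d105), and — at
PERFECT type — for WEAKLY perf-factorial divisor monoids (`IsPerfFactorialWeak`: (a)(b)(c) + (d_ord) + (d_res), the
notion available at the tempered Frobenioids of [EtTh] §3 over objects with infinitely many special-fibre components;
`PreFrobenioid.isPrimaryPreStep_map_of_preSteps_weak`, `Thm42PrimaryStepsWeak.lean`, seat abc-iut-f-038, over
abc-iut-L2-d2's `PrimaryDvdTotalWeak.lean`).  THIS FILE removes "perfect type": for Frobenioids `C_i → F_{Φ_i}` with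
`Φ_i` weakly perf-factorial under the typed `Thm42Setting` (standard and isotropic type, not group-like), MODULO ONLY
"`Ψ`, `Ψ⁻¹` preserve pre-steps" (Thm. 3.4 (ii), first clause), `Ψ` and `Ψ⁻¹` preserve primary pre-steps — by passage
to the perfections exactly as in `Thm42OfPreStepsGeneral.lean` (`Φ_i^pf` weakly perf-factorial:
`IsPerfFactorialWeak.perfection`, seat abc-iut-L2-d2) and descent (`FrdI.T42.perfectWLOG_of_equivalence`):
* `FrdI.T42.isPrimaryPreStep_map_of_preservesPreSteps_weak` / `…inverse_map…` — the binders `hprim` / `hprim'` of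
  the cell's [EtTh] Cor. 3.8 (iii) discharge over the weak data (`cor38_iii_ofRlfZWeak…`, abc-iut-L2-d2);
* `FrdI.T42.preservesPrimarySteps_ofFunctor_of_preservesPreSteps_weak` — the first conjunct of the typed
  `PreFrobenioidData.Thm42i` in this generality;
* `FrdI.T42.isPrimaryPreStep_map_of_preservesPreSteps_of_isPerfFactorial` — printed case via `IsPerfFactorial.weak`.
No new definitions; no landed declaration touched; a named hypothesis is WEAKENED, nothing of the paper is
restated or strengthened.  HONEST FRAMING: classical monoid/category algebra of [FrdI] §4; nothing here bears on
[IUTchIII] Cor. 3.12.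
-/

namespace Literature.AlgebraicGeometry.Frobenioids

open CategoryTheory Opposite

universe w v v' u u'

/-! ### Frobenioids not of perfect type: passage to the perfections, weak hypothesis -/

namespace FrdI.T42

open PreFrobenioidData PreFrobenioid.Perfection

variable {D₁ : Type u} [Category.{v} D₁] {Φ₁ : D₁ᵒᵖ ⥤ CommMonCat.{w}} {C₁ : Type u'} [Category.{v'} C₁]
  {D₂ : Type u} [Category.{v} D₂] {Φ₂ : D₂ᵒᵖ ⥤ CommMonCat.{w}} {C₂ : Type u'} [Category.{v'} C₂]
  {F₁ : C₁ ⥤ ElemFrobenioid Φ₁} {F₂ : C₂ ⥤ ElemFrobenioid Φ₂} (Ψ : C₁ ≌ C₂)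

set_option backward.isDefEq.respectTransparency false in
/-- **[FrdI] Thm. 4.2 (i), "`Ψ` preserves primary steps", for Frobenioids `C_i → F_{Φ_i}` with `Φ_i` WEAKLY
perf-factorial, NOT assumed of perfect type, under the typed `Thm42Setting` (standard and isotropic type, not
group-like) and MODULO ONLY "`Ψ`, `Ψ⁻¹` preserve pre-steps"** (Thm. 3.4 (ii), first clause).  Proof = print's
(p. 78 ll. 40–46, "passing to the perfections"): `Ψ^pf` exists (`isFrobeniusCompatible_of_preservesPreSteps`);
`C_i^pf` is a Frobenioid (Prop. 3.2 (iii)) of perfect, isotropic, standard (Prop. 5.5 (iii)) type with `Φ_i^pf`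
weakly perf-factorial (`IsPerfFactorialWeak.perfection`); `Ψ^pf`, `(Ψ^pf)⁻¹` preserve pre-steps over the printed
FSMFF bases of standard type (d) (`FrdI.isPreStep_map_of_isOfPerfectType`), hence primary pre-steps
(`isPrimaryPreStep_map_of_preSteps_weak`); descent to the `C_i` by `perfectWLOG_of_equivalence` (Prop. 3.2,
Prop. 5.5 (iii): `C → C^pf` preserves and reflects primary pre-steps). [cite: MochizukiFrdI2008, Thm. 4.2 (i) p.78] -/
theorem isPrimaryPreStep_map_of_preservesPreSteps_weak (hF₁ : PreFrobenioid.IsFrobenioid F₁)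
    (hF₂ : PreFrobenioid.IsFrobenioid F₂)
    (hpf₁ : Objectwise (fun M _ => IsPerfFactorialWeak M) Φ₁)
    (hpf₂ : Objectwise (fun M _ => IsPerfFactorialWeak M) Φ₂)
    (hpre : ∀ ⦃X Y : C₁⦄ (φ : X ⟶ Y), PreFrobenioid.IsPreStep F₁ φ → PreFrobenioid.IsPreStep F₂ (Ψ.functor.map φ))
    (hpre' : ∀ ⦃X Y : C₂⦄ (φ : X ⟶ Y), PreFrobenioid.IsPreStep F₂ φ → PreFrobenioid.IsPreStep F₁ (Ψ.inverse.map φ))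
    (hT : Thm42Setting (ofFunctor Φ₁ F₁) (ofFunctor Φ₂ F₂)) ⦃X Y : C₁⦄ (φ : X ⟶ Y)
    (hφ : PreFrobenioid.IsPrimaryPreStep F₁ φ) : PreFrobenioid.IsPrimaryPreStep F₂ (Ψ.functor.map φ) := by
  obtain ⟨hi₁, hi₂, -, -, ⟨N₁, hN₁⟩, ⟨N₂, hN₂⟩⟩ := of_thm42Setting hT
  have hs₁ := hT.standard.1
  have hs₂ := hT.standard.2
  have hq₁ := hs₁.quasiIsotropic
  have hq₂ := hs₂.quasiIsotropic
  -- `Ψ^pf` is defined: `Ψ` is compatible with arrows of Frobenius type (Thm. 3.4 (iii) from pre-steps)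
  have hΨ : PreFrobenioid.IsFrobeniusCompatible F₁ F₂ Ψ.functor :=
    isFrobeniusCompatible_of_preservesPreSteps hF₁ hF₂ hq₁ hq₂ hs₁.nonDilating hs₂.nonDilating Ψ
      (fun _ _ φ h => hpre φ h) (fun _ _ φ h => hpre' φ h) ⟨N₁, hN₁⟩ ⟨N₂, hN₂⟩
  haveI := map_isEquivalence (hF₁ := hF₁) (hF₂ := hF₂) Ψ hΨ
  have hiso₁ := isFrobeniusIsotropic_of_isOfIsotropicType hF₁ hi₁
  have hiso₂ := isFrobeniusIsotropic_of_isOfIsotropicType hF₂ hi₂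
  -- Prop. 3.2 (iii): the perfections are Frobenioids of perfect and isotropic type
  have hPf₁ := PreFrobenioid.Perfection.isFrobenioid hF₁ hiso₁
  have hPf₂ := PreFrobenioid.Perfection.isFrobenioid hF₂ hiso₂
  have hperfP₁ : PreFrobenioid.IsOfPerfectType (ops hF₁).toFunctor :=
    (ofFunctor_isOfPerfectType (ops hF₁).toFunctor).1 (isOfPerfectType_perfection hF₁ hiso₁)
  have hperfP₂ : PreFrobenioid.IsOfPerfectType (ops hF₂).toFunctor :=
    (ofFunctor_isOfPerfectType (ops hF₂).toFunctor).1 (isOfPerfectType_perfection hF₂ hiso₂)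
  have histrP₁ : PreFrobenioid.IsOfIsotropicType (ops hF₁).toFunctor := isOfIsotropicType_toFunctor hF₁ hiso₁
  have histrP₂ : PreFrobenioid.IsOfIsotropicType (ops hF₂).toFunctor := isOfIsotropicType_toFunctor hF₂ hiso₂
  -- Prop. 5.5 (iii): of standard type (hence over FSMFF bases, clause (d))
  have hng₁ : ¬ PreFrobenioid.IsOfType (PreFrobenioid.IsGroupLikeObj F₁) := fun h => hN₁ (h N₁)
  have hng₂ : ¬ PreFrobenioid.IsOfType (PreFrobenioid.IsGroupLikeObj F₂) := fun h => hN₂ (h N₂)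
  have hnorm₁ : PreFrobenioid.IsOfType (PreFrobenioid.IsFrobeniusNormalized F₁) :=
    fun X => hs₁.frobeniusNormalized.obj X
  have hnorm₂ : PreFrobenioid.IsOfType (PreFrobenioid.IsFrobeniusNormalized F₂) :=
    fun X => hs₂.frobeniusNormalized.obj X
  have hsP₁ := FrdI.Prop55Sub.prop55iii_pf_standard_of_not_groupLike hF₁ hPf₁ hng₁ hiso₁ hnorm₁ hs₁
  have hsP₂ := FrdI.Prop55Sub.prop55iii_pf_standard_of_not_groupLike hF₂ hPf₂ hng₂ hiso₂ hnorm₂ hs₂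
  -- Def. 2.4 (i), p. 48: `Φ_i^pf` weakly perf-factorial
  have hpfP₁ : Objectwise (fun M _ => IsPerfFactorialWeak M) (ops hF₁).monFunctor :=
    fun X => (hpf₁ X).perfection
  have hpfP₂ : Objectwise (fun M _ => IsPerfFactorialWeak M) (ops hF₂).monFunctor :=
    fun X => (hpf₂ X).perfection
  -- Thm. 3.4 (ii) for `Ψ^pf` and its quasi-inverse (perfect type, printed FSMFF bases of standard type (d))
  have hpreP : ∀ ⦃X Y : PreFrobenioid.Perfection hF₁⦄ (f : X ⟶ Y),
      PreFrobenioid.IsPreStep (ops hF₁).toFunctor f →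
        PreFrobenioid.IsPreStep (ops hF₂).toFunctor
          ((map (hF₁ := hF₁) (hF₂ := hF₂) hΨ).asEquivalence.functor.map f) :=
    fun _ _ _ hf => FrdI.isPreStep_map_of_isOfPerfectType hPf₁ hPf₂ histrP₁ histrP₂ hperfP₁ hsP₂.fsmff
      (map (hF₁ := hF₁) (hF₂ := hF₂) hΨ).asEquivalence hf
  have hpreP' : ∀ ⦃X Y : PreFrobenioid.Perfection hF₂⦄ (f : X ⟶ Y),
      PreFrobenioid.IsPreStep (ops hF₂).toFunctor f →
        PreFrobenioid.IsPreStep (ops hF₁).toFunctor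
          ((map (hF₁ := hF₁) (hF₂ := hF₂) hΨ).asEquivalence.inverse.map f) :=
    fun _ _ _ hf => FrdI.isPreStep_map_of_isOfPerfectType hPf₂ hPf₁ histrP₂ histrP₁ hperfP₂ hsP₁.fsmff
      (map (hF₁ := hF₁) (hF₂ := hF₂) hΨ).asEquivalence.symm hf
  have hstepP : ∀ ⦃X Y : PreFrobenioid.Perfection hF₁⦄ (f : X ⟶ Y),
      PreFrobenioid.IsStep (ops hF₁).toFunctor f →
        PreFrobenioid.IsStep (ops hF₂).toFunctor
          ((map (hF₁ := hF₁) (hF₂ := hF₂) hΨ).asEquivalence.functor.map f) :=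
    fun _ _ _ hf => FrdI.OfPreSteps.isStep_map (map (hF₁ := hF₁) (hF₂ := hF₂) hΨ).asEquivalence
      (fun _ _ f h => hpreP f h) hf
  -- Thm. 4.2 (i) for `Ψ^pf` (perfect type, weak hypothesis)
  have hprim_pf : ∀ ⦃X Y : PreFrobenioid.Perfection hF₁⦄ (f : X ⟶ Y), (ops hF₁).IsPrimaryPreStep f →
      (ops hF₂).IsPrimaryPreStep ((map (hF₁ := hF₁) (hF₂ := hF₂) hΨ).map f) :=
    fun _ _ _ h => PreFrobenioid.isPrimaryPreStep_map_of_preSteps_weak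
      (map (hF₁ := hF₁) (hF₂ := hF₂) hΨ).asEquivalence hPf₁ hPf₂ hperfP₁ hperfP₂ histrP₁ histrP₂ hpfP₁ hpfP₂
      hstepP hpreP hpreP' h
  -- row T42-L03: transport down to the `C_i`
  exact (perfectWLOG_of_equivalence hF₁ hF₂ Ψ hΨ).1 hprim_pf φ hφ

/-- … **and the quasi-inverse `Ψ⁻¹` preserves primary pre-steps** (the previous statement for `Ψ.symm`; the
typed hypotheses are symmetric, `thm42Setting_symm`). [cite: MochizukiFrdI2008, Thm. 4.2 (i) p.78] -/
theorem isPrimaryPreStep_inverse_map_of_preservesPreSteps_weak (hF₁ : PreFrobenioid.IsFrobenioid F₁)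
    (hF₂ : PreFrobenioid.IsFrobenioid F₂)
    (hpf₁ : Objectwise (fun M _ => IsPerfFactorialWeak M) Φ₁)
    (hpf₂ : Objectwise (fun M _ => IsPerfFactorialWeak M) Φ₂)
    (hpre : ∀ ⦃X Y : C₁⦄ (φ : X ⟶ Y), PreFrobenioid.IsPreStep F₁ φ → PreFrobenioid.IsPreStep F₂ (Ψ.functor.map φ))
    (hpre' : ∀ ⦃X Y : C₂⦄ (φ : X ⟶ Y), PreFrobenioid.IsPreStep F₂ φ → PreFrobenioid.IsPreStep F₁ (Ψ.inverse.map φ))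
    (hT : Thm42Setting (ofFunctor Φ₁ F₁) (ofFunctor Φ₂ F₂)) ⦃X Y : C₂⦄ (φ : X ⟶ Y)
    (hφ : PreFrobenioid.IsPrimaryPreStep F₂ φ) : PreFrobenioid.IsPrimaryPreStep F₁ (Ψ.inverse.map φ) :=
  isPrimaryPreStep_map_of_preservesPreSteps_weak Ψ.symm hF₂ hF₁ hpf₂ hpf₁ (fun _ _ φ h => hpre' φ h)
    (fun _ _ φ h => hpre φ h) (thm42Setting_symm hT) φ hφ

/-- **Theorem 4.2 (i), first conjunct AS TYPED** (`PreFrobenioidData.Thm42i`: "`Ψ` preserves the steps that are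
primary pre-steps"), for Frobenioids with `Φ_i` WEAKLY perf-factorial, not assumed of perfect type, MODULO "`Ψ`,
`Ψ⁻¹` preserve pre-steps" — steps by reflection of isomorphisms along the fully faithful `Ψ`, primary pre-steps
by `isPrimaryPreStep_map_of_preservesPreSteps_weak`. [cite: MochizukiFrdI2008, Thm. 4.2 (i) p.77] -/
theorem preservesPrimarySteps_ofFunctor_of_preservesPreSteps_weak (hF₁ : PreFrobenioid.IsFrobenioid F₁)
    (hF₂ : PreFrobenioid.IsFrobenioid F₂)
    (hpf₁ : Objectwise (fun M _ => IsPerfFactorialWeak M) Φ₁)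
    (hpf₂ : Objectwise (fun M _ => IsPerfFactorialWeak M) Φ₂)
    (hpre : ∀ ⦃X Y : C₁⦄ (φ : X ⟶ Y), PreFrobenioid.IsPreStep F₁ φ → PreFrobenioid.IsPreStep F₂ (Ψ.functor.map φ))
    (hpre' : ∀ ⦃X Y : C₂⦄ (φ : X ⟶ Y), PreFrobenioid.IsPreStep F₂ φ → PreFrobenioid.IsPreStep F₁ (Ψ.inverse.map φ))
    (hT : Thm42Setting (ofFunctor Φ₁ F₁) (ofFunctor Φ₂ F₂)) :
    PreservesMor Ψ.functor (fun _ _ φ => (ofFunctor Φ₁ F₁).IsStep φ ∧ (ofFunctor Φ₁ F₁).IsPrimaryPreStep φ)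
      (fun _ _ φ => (ofFunctor Φ₂ F₂).IsStep φ ∧ (ofFunctor Φ₂ F₂).IsPrimaryPreStep φ) :=
  fun X Y φ hφ => ⟨⟨hpre φ hφ.1.1, fun h => hφ.1.2
      (by haveI := h; exact Ψ.fullyFaithfulFunctor.isIso_of_isIso_map φ)⟩,
    isPrimaryPreStep_map_of_preservesPreSteps_weak Ψ hF₁ hF₂ hpf₁ hpf₂ hpre hpre' hT φ hφ.2⟩

/-- **Printed case recovered**: for `Φ_i` perf-factorial as printed (Def. 2.4 (i) (a)–(d)) the weak-hypothesis
theorem specialises, via `IsPerfFactorial.weak`, to the primary-steps conjunct of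
`thm42i_ofFunctor_of_preservesPreSteps`. [cite: MochizukiFrdI2008, Thm. 4.2 (i) p.77] -/
theorem isPrimaryPreStep_map_of_preservesPreSteps_of_isPerfFactorial (hF₁ : PreFrobenioid.IsFrobenioid F₁)
    (hF₂ : PreFrobenioid.IsFrobenioid F₂)
    (hpf₁ : Objectwise (fun M _ => IsPerfFactorial M) Φ₁) (hpf₂ : Objectwise (fun M _ => IsPerfFactorial M) Φ₂)
    (hpre : ∀ ⦃X Y : C₁⦄ (φ : X ⟶ Y), PreFrobenioid.IsPreStep F₁ φ → PreFrobenioid.IsPreStep F₂ (Ψ.functor.map φ))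
    (hpre' : ∀ ⦃X Y : C₂⦄ (φ : X ⟶ Y), PreFrobenioid.IsPreStep F₂ φ → PreFrobenioid.IsPreStep F₁ (Ψ.inverse.map φ))
    (hT : Thm42Setting (ofFunctor Φ₁ F₁) (ofFunctor Φ₂ F₂)) ⦃X Y : C₁⦄ (φ : X ⟶ Y)
    (hφ : PreFrobenioid.IsPrimaryPreStep F₁ φ) : PreFrobenioid.IsPrimaryPreStep F₂ (Ψ.functor.map φ) :=
  isPrimaryPreStep_map_of_preservesPreSteps_weak Ψ hF₁ hF₂ (fun X => (hpf₁ X).weak) (fun X => (hpf₂ X).weak)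
    hpre hpre' hT φ hφ

end FrdI.T42

end Literature.AlgebraicGeometry.Frobenioids
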